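import Literature.MathematicalPhysics.QuantumFieldTheory.Balaban1983to89.B5G183KernelDecay

/-!
# `Balaban1983to89.B5G183FreeUniform` — periodisation when the period exceeds the decay length, and the `n`-UNIFORM
exponential decay of the WHOLE kernel of `G = Δ_1⁻¹` between block points in the coarse torus distance

T. Bałaban, *Propagators and renormalization transformations for lattice gauge theories. I*, Commun. Math.
Phys. **95**, 17–40 (1984) [`Balaban1984PropagatorsI`, cell paper B5].  What the paper PRINTS (verbatim; renders
`b2b-balaban-ref1/pages/1984-cmp95-propagators-rt-I/…-p019-x2.png` (journal p. 35) and `…-p020-x2.png` (p. 36) read as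
images by this seat):
* p. 35 [PDF 19], Proposition 1.2, first display: «There exists a positive constant δ₀ depending on d only, such that
  |(GJ)(x)|, |(∇GJ)(x)|, |(G∇*J)(x)|, |(ΔGJ)(x)| ≤ O(1)e^{−δ₀|y−y′|}|J|  (1.110)  for x ∈ Δ̃(y), supp J ⊂ Δ̃(y′), with
  the constant O(1) depending on d only,»;
* p. 36 [PDF 20], ll. 20–23: «Probably the simplest proof of the exponential decay properties can be obtained by
  relating G on the torus to G on the whole lattice ηZ^d in the usual way, and then proving that the operator
  e^{−⟨q,x⟩}Δ_a e^{⟨q,x⟩} − Δ_a is a small perturbation of Δ_a for vectors q ∈ R^d sufficiently small.»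

CITATION HEADER (lean-in-tree rule).  This module is a SUPPLEMENT, not a quotation.  It finishes, at the level of
kernel ENTRIES and for `a = 1`, `U = 1`, the road of the p. 36 remark for the FIRST entry of (1.110): after
`B5G183KernelDecay` (covariant part of the kernel of `G = Δ_1⁻¹` between block points, `n`-uniform decay; free part =
fine-torus kernel of `freeMult` with an `n`-DEPENDENT torus constant, its HONEST SCOPE (iii)) it supplies the missing
`n`-uniform periodisation of the free part.  The printed proof of Prop. 1.2 (pp. 36–39, random-walk expansion) is NOT
followed and no printed constant (`δ₀`, `O(1)`) is compared with ours.  Every declaration is `[folklore]` audit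
mathematics; `[cite: …]` tags mark the location of printed TEXT only.  ABSOLUTE RULE honoured: no statement of the
papers is used as a hypothesis; nothing internally minted is cited as a fact.

CONTENT.
* §1–§3 (generic engine, beside `B4TorusKernel.MultiPeriod`; no B5 object): PERIODISATION WHEN THE PERIOD EXCEEDS THE
  DECAY LENGTH.  `B4TorusKernel.MultiPeriod.periodise_bound` bounds `Σ_m K(x + Pm)` for `‖K y‖ ≤ A e^{−κ|y|_∞}` by
  `A · periodConst κ d · e^{−(κ/(d+1))|x|_∞}` with `periodConst κ d = (2e^{κ′}/(1 − e^{−κ′}))^{d+1} ~ (2/κ′)^{d+1}`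
  (`κ′ = κ/(d+1)`) as `κ → 0` — it forgets that the images are `P_i` apart.  Here (`abs_add_mul_ge_large`: for a
  centred `y`, `|y + Pj| ≥ |y| + P(|j| − 1)`; `summable_geometric_int_shift`: `Σ_{j∈ℤ} r^{(|j|−1)} = 1 + 2/(1 − r)`)
  the constant becomes `(1 + 2/(1 − e^{−ρ}))^{d+1}` for ANY `ρ > 0` with `ρ ≤ κ′ P_i` for all `i`
  (`periodise_bound_large`, `torusKernel_decay_torusMetric_large`, `torusKernel_descend_decay_torusMetric_large`):
  it depends on the product (rate × period) only.
* §4 (generic): fine versus coarse torus distance, `n · circAbs M u − |s| ≤ circAbs (nM) (nu + s)`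
  (`circAbs_fine_ge`, `torusSupNorm_fine_ge`).
* §5 (B5, the fine torus `T_η`, `P_i = n M_i`, `κ = r(d+1)/n`, so `κ′ P_i = r(d+1) M_i/(d+1) ≥ r(d+1)/(d+1)`):
  **`torusKernel_freeMult_decay_uniform`** — `‖MultiPeriod.torusKernel (descendC (freeMult n N)) (fine n M) m‖ ≤
  MF(N) · (1 + 2/(1 − e^{−r(d+1)/(d+1)}))^{d+1} · e^{−((r(d+1)/n)/(d+1))·|m|_{T_η,∞}}`, constant a function of `d, N`
  ONLY (closes `B5G183FreeDecay` HONEST SCOPE (v) and `B5G183KernelDecay` HONEST SCOPE (iii)).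
* §6 (B5, block points `n·x̄ + r`): `torusSupNorm_bpt_ge` (`n|x − x′|_{T₁,∞} − (n − 1) ≤ |(nx + r) − (nx′ + r′)|_{T_η,∞}`),
  **`norm_freePart_bpt_le_uniform`**, and the HEADLINE **`norm_DeltaA_one_inv_bpt_le_uniform`** /
  **`norm_DeltaA_one_inv_bpt_le_uniform'`**: for `a = 1`, `U = 1`, every `n ≥ 1`, `N + 1 ≥ d + 1`, every coarse torus,
  `‖(Δ_1⁻¹)_{(n x̄+r,μ),(n x̄′+r′,ν)}‖ ≤ C(d,N) · e^{−δ(d)·|x − x′|_{T₁,∞}}` with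
  `C(d,N) = MF(N)·(1 + 2/(1 − e^{−ρ_F}))^{d+1}·e^{ρ_F} + MD183(d+1,N)·periodConst(κ₁₈₃(d+1),d)`,
  `δ(d) = min(ρ_F, κ₁₈₃(d+1)/(d+1))`, `ρ_F = r(d+1)/(d+1)` — EVERY constant and rate a function of `d, N` only, uniform
  in `n = L^k` and in the torus (the covariant half is `B5G183KernelDecay.norm_DeltaA_one_inv_bpt_sub_free_le` BY NAME
  and keeps its extra factor `n^{−(d+1)}` in the unprimed form).

HONEST SCOPE.  (i) ENTRIES of the kernel between block points `n·ȳ + r` (every point of `T_η` is one), NOT the operator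
form `|(GJ)(x)| ≤ O(1)e^{−δ₀|y−y′|}|J|` of (1.110) nor its other entries (`∇G`, `G∇*`, `ΔG`, Hölder quotients, L²
forms): the passage entries → operator needs row sums over a block (`n^{d+1}` fine points), for which `n^{d+1}` times
an entry majorant is the wrong currency (row sums, not entry sups, are what the operator form needs; not typed here) —
consumer's business (t4-ne2-p2, GAPS G-ne2p2-9 (β)).  (ii) `a = 1` (convention of `B5G183Strip`),
`U = 1`, finite torus, mass `1` in coarse units; the `η^{d+1}`-normalisation dictionary of (1.29) is `B5DeltaA169`'s.
(iii) Rates/constants crude and ours; nothing printed is matched.  (iv) No `def` is introduced; the constants are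
written out (`(1 + 2/(1 − e^{−ρ}))^{d+1}`), every object is an existing tree declaration used BY NAME.  NEAREST TREE
NEIGHBOURS (searched `B4TorusKernel` §3/§7/§8, `Beta/TorusG0*`, `Beta/DeltaACombesThomas`, `B5Decay126`,
`B5Hk163Torus*`, `B5Kernel166Decay`): the only periodisation engines in the tree are `B4TorusKernel.periodise_bound` /
`MultiPeriod.periodise_bound` (constant `periodConst`); no large-period form exists; `Beta/DeltaACombesThomas` is
conditional (hypothesis `hP`) and general-`a`, neither implies the other.  Value = kernel certificate (the typed,
`n`-uniform decay of the entries of Bałaban's `G` itself at `a = 1`), NOT summit progress.  Unit `b2b-balaban-pv15-g12`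
(PV15 cell lineage, generation 12).
-/

open scoped BigOperators Matrix ComplexConjugate Real
open Finset Complex Matrix

namespace Literature.MathematicalPhysics.QuantumFieldTheory.Balaban1983to89.B5G183FreeUniform

open UnitAddTorus (mFourierCoeff)
open Literature.MathematicalPhysics.QuantumFieldTheory.Balaban1983to89.B4Strip (ofRealVec)
open Literature.MathematicalPhysics.QuantumFieldTheory.Balaban1983to89.B4StripCauchy (rOf rOf_pos)
open Literature.MathematicalPhysics.QuantumFieldTheory.Balaban1983to89.B4ContourShift (StripRegular supNorm
  exists_supNorm_eq abs_le_supNorm supNorm_nonneg latticeKernel)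
open Literature.MathematicalPhysics.QuantumFieldTheory.Balaban1983to89.B4TorusKernel (descendC summable_prod_pi
  exp_supNorm_le_prod summable_of_decay supNorm_neg norm_mFourierCoeff_descend_le periodConst)
open Literature.MathematicalPhysics.QuantumFieldTheory.Balaban1983to89.B4TorusKernel.MultiPeriod (translate
  translate_apply torusKernel torusKernel_eq_periodise torusSupNorm torusSupNorm_nonneg circAbs centre centreVec
  circAbs_add_mul abs_add_mul_centre circAbs_le_abs circAbs_nonneg torusKernel_translate supNorm_translate_centreVec
  translate_centreVec_centred)
open Literature.MathematicalPhysics.QuantumFieldTheory.Balaban1983to89.B5Prop11Plancherel (Tor fine)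
open Literature.MathematicalPhysics.QuantumFieldTheory.Balaban1983to89.B5Prop11Lower (Lap)
open Literature.MathematicalPhysics.QuantumFieldTheory.Balaban1983to89.B5Block118 (bpt)
open Literature.MathematicalPhysics.QuantumFieldTheory.Balaban1983to89.B5DeltaA169 (DeltaA)
open Literature.MathematicalPhysics.QuantumFieldTheory.Balaban1983to89.B5G183Strip (kappa183 kappa183_pos)
open Literature.MathematicalPhysics.QuantumFieldTheory.Balaban1983to89.B5G183CovDecay (MD183 MD183_nonneg)
open Literature.MathematicalPhysics.QuantumFieldTheory.Balaban1983to89.B5G183FreeDecay (freeMult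
  stripRegular_freeMult rOf_div_pos rOf_div_admissible MF MF_nonneg)
open Literature.MathematicalPhysics.QuantumFieldTheory.Balaban1983to89.B5Kernel166Decay (periodConst_pos)
open Literature.MathematicalPhysics.QuantumFieldTheory.Balaban1983to89.B6LowerBound2153Torus (toT)
open Literature.MathematicalPhysics.QuantumFieldTheory.Balaban1983to89.B6Cov2156Torus (one_le_M)
open Literature.MathematicalPhysics.QuantumFieldTheory.Balaban1983to89.B5G183KernelDecay (bpt_toT
  freePart_toT_eq_torusKernel norm_DeltaA_one_inv_bpt_sub_free_le)

noncomputable section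

variable {d : ℕ}

/-! ## §1. One dimension: the periodised exponential when the period exceeds the decay length -/

section OneDim

/-- for a centred representative `2|y| ≤ P` (`P ≥ 1`) and every `j ∈ ℤ`: `|y| + P·(|j| − 1) ≤ |y + P j|`
(truncated subtraction, so the case `j = 0` reads `|y| ≤ |y|`). [folklore] -/
theorem abs_add_mul_ge_large (y j : ℤ) {P : ℕ} (hy : 2 * |y| ≤ P) :
    (|y| : ℤ) + P * ((j.natAbs - 1 : ℕ) : ℤ) ≤ |y + P * j| := by
  rcases eq_or_ne j 0 with rfl | hj
  · simp
  · have hj1 : 1 ≤ j.natAbs := Int.natAbs_pos.mpr hj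
    have e : ((j.natAbs - 1 : ℕ) : ℤ) = |j| - 1 := by
      rw [Nat.cast_sub hj1, Int.natCast_natAbs]
      simp
    rw [e]
    have h1 : (P : ℤ) * |j| - |y| ≤ |y + P * j| := by
      have h := abs_sub ((P : ℤ) * j) (-y)
      have h' := abs_sub_abs_le_abs_sub ((P : ℤ) * j) (-y)
      rw [abs_mul, abs_neg, Nat.abs_cast] at h'
      have e' : (P : ℤ) * j - -y = y + P * j := by ring
      rw [e'] at h'
      linarith
    nlinarith [abs_nonneg j, abs_nonneg y]

/-- ONE-DIMENSIONAL PERIODISED EXPONENTIAL, large period: for `0 ≤ κ`, `2|y| ≤ P` and every `j ∈ ℤ`,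
`e^{−κ|y + Pj|} ≤ e^{−κ|y|} · (e^{−κP})^{(|j| − 1)}` (truncated exponent). [folklore] -/
theorem exp_translate_le_large {κ : ℝ} (hκ : 0 ≤ κ) (y j : ℤ) {P : ℕ} (hy : 2 * |y| ≤ P) :
    Real.exp (-(κ * |((y + P * j : ℤ) : ℝ)|))
      ≤ Real.exp (-(κ * |(y : ℝ)|)) * Real.exp (-(κ * P)) ^ (j.natAbs - 1) := by
  rw [← Real.exp_nat_mul, ← Real.exp_add]
  apply Real.exp_le_exp.mpr
  have h := abs_add_mul_ge_large y j hy
  have h' : ((|y| : ℤ) : ℝ) + (P : ℝ) * ((j.natAbs - 1 : ℕ) : ℝ) ≤ ((|y + P * j| : ℤ) : ℝ) := by exact_mod_cast h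
  have e1 : ((|y + ↑P * j| : ℤ) : ℝ) = |((y + P * j : ℤ) : ℝ)| := by push_cast; rfl
  have e2 : ((|y| : ℤ) : ℝ) = |(y : ℝ)| := by push_cast; rfl
  rw [e1, e2] at h'
  have ht : (0 : ℝ) ≤ ((j.natAbs - 1 : ℕ) : ℝ) := by positivity
  nlinarith [mul_le_mul_of_nonneg_left h' hκ]

/-- the shifted two-sided geometric series: for `0 ≤ r < 1`, `Σ_{j ∈ ℤ} r^{(|j| − 1)} = 1 + 2/(1 − r)`
(`j = 0` contributes `r⁰ = 1`, each `j ≠ 0` contributes `r^{|j|−1}`). [folklore] -/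
theorem summable_geometric_int_shift {r : ℝ} (h0 : 0 ≤ r) (h1 : r < 1) :
    Summable (fun j : ℤ => r ^ (j.natAbs - 1)) ∧ ∑' j : ℤ, r ^ (j.natAbs - 1) = 1 + 2 / (1 - r) := by
  set f : ℤ → ℝ := fun j => r ^ (j.natAbs - 1) with hf
  have hg := summable_geometric_of_lt_one h0 h1
  have hnat : (fun n : ℕ => f n) = fun n => r ^ (n - 1) := by
    funext n; simp [hf]
  have hneg1 : (fun n : ℕ => f (-(n + 1 : ℤ))) = fun n => r ^ n := by
    funext n
    simp only [hf]
    rw [show ((-(n + 1 : ℤ)).natAbs - 1 : ℕ) = n by omega]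
  have hshift : (fun n : ℕ => r ^ (n + 1 - 1)) = fun n => r ^ n := by
    funext n; simp
  have h1' : Summable fun n : ℕ => r ^ (n - 1) :=
    (summable_nat_add_iff 1).mp (by rw [hshift]; exact hg)
  have hf1 : Summable fun n : ℕ => f n := by rw [hnat]; exact h1'
  have hf3 : Summable fun n : ℕ => f (-(n + 1 : ℤ)) := by rw [hneg1]; exact hg
  have hs : Summable f := Summable.of_nat_of_neg_add_one hf1 hf3
  refine ⟨hs, ?_⟩
  rw [tsum_of_nat_of_neg_add_one (f := f) hf1 hf3, hnat, hneg1, h1'.tsum_eq_zero_add, hshift,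
    tsum_geometric_of_lt_one h0 h1, Nat.zero_sub, pow_zero]
  have hpos : (1 - r) ≠ 0 := by linarith
  field_simp
  ring

end OneDim

/-! ## §2. Periodisation over `Π_i P_i ℤ` when every period exceeds the decay length: `ρ ≤ (κ/(d+1))·P_i` -/

section Periodise

/-- TERMWISE MAJORANT, large periods: for a centred representative `x` (`2|x_i| ≤ P_i`) and
`‖K y‖ ≤ A e^{−κ|y|_∞}`: `‖K(x + Pm)‖ ≤ A · e^{−κ′ Σ_i |x_i|} · Π_i (e^{−κ′P_i})^{(|m_i| − 1)}`, `κ′ = κ/(d+1)`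
(compare `B4TorusKernel.MultiPeriod.norm_translate_le`, whose factor `e^{κ′(d+1)} Π_i (e^{−κ′})^{|m_i|}` forgets the
size of the periods). [folklore] -/
theorem norm_translate_le_large (K : (Fin (d + 1) → ℤ) → ℂ) {κ A : ℝ} (hκ : 0 ≤ κ)
    (hK : ∀ y, ‖K y‖ ≤ A * Real.exp (-(κ * supNorm y))) (P : Fin (d + 1) → ℕ)
    (x : Fin (d + 1) → ℤ) (hx : ∀ i, 2 * |x i| ≤ P i) (m : Fin (d + 1) → ℤ) :
    ‖K (translate P x m)‖ ≤
      A * Real.exp (-(κ / (d + 1) * ∑ i, |((x i : ℤ) : ℝ)|))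
        * ∏ i, Real.exp (-(κ / (d + 1) * P i)) ^ ((m i).natAbs - 1) := by
  have hA : 0 ≤ A := by
    have h := hK 0
    nlinarith [norm_nonneg (K 0), Real.exp_pos (-(κ * supNorm (0 : Fin (d + 1) → ℤ)))]
  set κ' := κ / (d + 1) with hκ'
  have hκ'0 : 0 ≤ κ' := div_nonneg hκ (by positivity)
  have step : ∀ i, Real.exp (-(κ' * |((translate P x m i : ℤ) : ℝ)|))
      ≤ Real.exp (-(κ' * |((x i : ℤ) : ℝ)|)) * Real.exp (-(κ' * P i)) ^ ((m i).natAbs - 1) := by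
    intro i
    have := exp_translate_le_large hκ'0 (x i) (m i) (hx i)
    simpa using this
  calc ‖K (translate P x m)‖ ≤ A * Real.exp (-(κ * supNorm (translate P x m))) := hK _
    _ ≤ A * ∏ i, Real.exp (-(κ' * |((translate P x m i : ℤ) : ℝ)|)) :=
        mul_le_mul_of_nonneg_left (exp_supNorm_le_prod hκ _) hA
    _ ≤ A * ∏ i, (Real.exp (-(κ' * |((x i : ℤ) : ℝ)|)) * Real.exp (-(κ' * P i)) ^ ((m i).natAbs - 1)) := by
        apply mul_le_mul_of_nonneg_left _ hA
        exact Finset.prod_le_prod (fun i _ => (Real.exp_pos _).le) (fun i _ => step i)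
    _ = A * Real.exp (-(κ' * ∑ i, |((x i : ℤ) : ℝ)|))
        * ∏ i, Real.exp (-(κ' * P i)) ^ ((m i).natAbs - 1) := by
        rw [Finset.prod_mul_distrib, ← Real.exp_sum]
        have e : ∑ i, -(κ' * |((x i : ℤ) : ℝ)|) = -(κ' * ∑ i, |((x i : ℤ) : ℝ)|) := by
          rw [Finset.mul_sum, ← Finset.sum_neg_distrib]
        rw [e]
        ring

/-- **PERIODISATION BOUND, LARGE PERIODS.** For `κ > 0`, a lattice kernel with `‖K y‖ ≤ A e^{−κ|y|_∞}`, periods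
`P_i ≥ 1`, any `ρ > 0` with `ρ ≤ (κ/(d+1))·P_i` for all `i`, and a centred representative `x` (`2|x_i| ≤ P_i`):
`Σ_m K(x + Pm)` converges absolutely and
`‖Σ_m K(x + Pm)‖ ≤ A · (1 + 2/(1 − e^{−ρ}))^{d+1} · e^{−(κ/(d+1)) Σ_i |x_i|}` — the constant depends on the lower
bound `ρ` of (rate × period) only, NOT on `κ` and `P` separately (the nearest image is at distance `≥ P_i/2`, the
`t`-th one at `≥ |x_i| + P_i(t − 1)`). [folklore] -/
theorem periodise_bound_large (K : (Fin (d + 1) → ℤ) → ℂ) {κ A : ℝ} (hκ : 0 < κ)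
    (hK : ∀ y, ‖K y‖ ≤ A * Real.exp (-(κ * supNorm y))) {P : Fin (d + 1) → ℕ}
    {ρ : ℝ} (hρ : 0 < ρ) (hρP : ∀ i, ρ ≤ κ / (d + 1) * P i)
    (x : Fin (d + 1) → ℤ) (hx : ∀ i, 2 * |x i| ≤ P i) :
    Summable (fun m : Fin (d + 1) → ℤ => K (translate P x m)) ∧
      ‖∑' m : Fin (d + 1) → ℤ, K (translate P x m)‖
        ≤ A * (1 + 2 / (1 - Real.exp (-ρ))) ^ (d + 1) *
            Real.exp (-(κ / (d + 1) * ∑ i, |((x i : ℤ) : ℝ)|)) := by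
  set κ' := κ / (d + 1) with hκ'
  set r : Fin (d + 1) → ℝ := fun i => Real.exp (-(κ' * P i)) with hr
  have hr0 : ∀ i, 0 ≤ r i := fun i => (Real.exp_pos _).le
  have hr1 : ∀ i, r i ≤ Real.exp (-ρ) := fun i => Real.exp_le_exp.mpr (by have := hρP i; linarith)
  have hρ1 : Real.exp (-ρ) < 1 := Real.exp_lt_one_iff.mpr (by linarith)
  have hr1' : ∀ i, r i < 1 := fun i => lt_of_le_of_lt (hr1 i) hρ1
  have hgs : ∀ i, Summable (fun j : ℤ => r i ^ (j.natAbs - 1)) ∧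
      ∑' j : ℤ, r i ^ (j.natAbs - 1) = 1 + 2 / (1 - r i) :=
    fun i => summable_geometric_int_shift (hr0 i) (hr1' i)
  set B := A * Real.exp (-(κ' * ∑ i, |((x i : ℤ) : ℝ)|)) with hB
  obtain ⟨hps, hpe⟩ := summable_prod_pi (k := d + 1) (fun i j => r i ^ (j.natAbs - 1))
    (fun i j => pow_nonneg (hr0 i) _) (fun i => (hgs i).1)
  have hle : ∀ m : Fin (d + 1) → ℤ, ‖K (translate P x m)‖ ≤ B * ∏ i, r i ^ ((m i).natAbs - 1) :=
    fun m => norm_translate_le_large K hκ.le hK P x hx m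
  have hmaj : Summable (fun m : Fin (d + 1) → ℤ => B * ∏ i, r i ^ ((m i).natAbs - 1)) := hps.mul_left B
  refine ⟨Summable.of_norm_bounded hmaj hle, ?_⟩
  have hA : 0 ≤ A := by
    have h := hK 0
    nlinarith [norm_nonneg (K 0), Real.exp_pos (-(κ * supNorm (0 : Fin (d + 1) → ℤ)))]
  have hB0 : 0 ≤ B := by positivity
  have hC1 : ∀ i, 1 + 2 / (1 - r i) ≤ 1 + 2 / (1 - Real.exp (-ρ)) := fun i => by
    have h2 : 2 / (1 - r i) ≤ 2 / (1 - Real.exp (-ρ)) :=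
      div_le_div_of_nonneg_left (by norm_num) (by linarith) (by linarith [hr1 i])
    linarith
  have hC0 : ∀ i, 0 ≤ 1 + 2 / (1 - r i) := fun i =>
    add_nonneg zero_le_one (div_nonneg zero_le_two (by linarith [hr1' i]))
  calc ‖∑' m : Fin (d + 1) → ℤ, K (translate P x m)‖
      ≤ ∑' m : Fin (d + 1) → ℤ, B * ∏ i, r i ^ ((m i).natAbs - 1) := tsum_of_norm_bounded hmaj.hasSum hle
    _ = B * ∏ i, ∑' j : ℤ, r i ^ (j.natAbs - 1) := by rw [tsum_mul_left, hpe]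
    _ = B * ∏ i, (1 + 2 / (1 - r i)) := by
        congr 1
        exact Finset.prod_congr rfl fun i _ => (hgs i).2
    _ ≤ B * ∏ _i : Fin (d + 1), (1 + 2 / (1 - Real.exp (-ρ))) := by
        apply mul_le_mul_of_nonneg_left _ hB0
        exact Finset.prod_le_prod (fun i _ => hC0 i) (fun i _ => hC1 i)
    _ = A * (1 + 2 / (1 - Real.exp (-ρ))) ^ (d + 1) *
            Real.exp (-(κ / (d + 1) * ∑ i, |((x i : ℤ) : ℝ)|)) := by
        rw [Finset.prod_const, Finset.card_univ, Fintype.card_fin, hB]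
        ring

/-- the same bound in the sup norm of the centred representative (`Σ_i |x_i| ≥ |x|_∞`):
`‖Σ_m K(x + Pm)‖ ≤ A · (1 + 2/(1 − e^{−ρ}))^{d+1} · e^{−(κ/(d+1))|x|_∞}`. [folklore] -/
theorem periodise_bound_supNorm_large (K : (Fin (d + 1) → ℤ) → ℂ) {κ A : ℝ} (hκ : 0 < κ)
    (hK : ∀ y, ‖K y‖ ≤ A * Real.exp (-(κ * supNorm y))) {P : Fin (d + 1) → ℕ}
    {ρ : ℝ} (hρ : 0 < ρ) (hρP : ∀ i, ρ ≤ κ / (d + 1) * P i)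
    (x : Fin (d + 1) → ℤ) (hx : ∀ i, 2 * |x i| ≤ P i) :
    ‖∑' m : Fin (d + 1) → ℤ, K (translate P x m)‖
      ≤ A * (1 + 2 / (1 - Real.exp (-ρ))) ^ (d + 1) * Real.exp (-(κ / (d + 1) * supNorm x)) := by
  refine le_trans (periodise_bound_large K hκ hK hρ hρP x hx).2 ?_
  have hA : 0 ≤ A := by
    have h := hK 0
    nlinarith [norm_nonneg (K 0), Real.exp_pos (-(κ * supNorm (0 : Fin (d + 1) → ℤ)))]
  have hρ1 : Real.exp (-ρ) < 1 := Real.exp_lt_one_iff.mpr (by linarith)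
  have hC : 0 ≤ (1 + 2 / (1 - Real.exp (-ρ))) ^ (d + 1) :=
    pow_nonneg (add_nonneg zero_le_one (div_nonneg zero_le_two (by linarith))) _
  apply mul_le_mul_of_nonneg_left _ (mul_nonneg hA hC)
  apply Real.exp_le_exp.mpr
  obtain ⟨i, hi⟩ := exists_supNorm_eq x
  have : supNorm x ≤ ∑ j, |((x j : ℤ) : ℝ)| := by
    rw [hi, Int.cast_abs]
    exact Finset.single_le_sum (f := fun j => |((x j : ℤ) : ℝ)|) (fun j _ => abs_nonneg _) (Finset.mem_univ i)
  have hκ' : 0 ≤ κ / (d + 1) := div_nonneg hκ.le (by positivity)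
  nlinarith

end Periodise

/-! ## §3. The torus kernel on `Π_i ℤ/P_i` in the torus metric, large periods -/

section Torus

/-- UNIFORM DECAY OF THE TORUS KERNEL, large periods, centred representatives: `‖ĉ(n)‖ ≤ A e^{−κ|n|_∞}`, `κ > 0`,
`P_i ≥ 1`, `ρ ≤ (κ/(d+1)) P_i`, `2|x_i| ≤ P_i` ⇒ `‖K_P(x)‖ ≤ A · (1 + 2/(1 − e^{−ρ}))^{d+1} · e^{−(κ/(d+1))|x|_∞}`.
[folklore] -/
theorem torusKernel_decay_large (f : C(UnitAddTorus (Fin (d + 1)), ℂ)) {κ A : ℝ} (hκ : 0 < κ)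
    (hdec : ∀ n, ‖mFourierCoeff f n‖ ≤ A * Real.exp (-(κ * supNorm n))) {P : Fin (d + 1) → ℕ}
    (hP : ∀ i, 1 ≤ P i) {ρ : ℝ} (hρ : 0 < ρ) (hρP : ∀ i, ρ ≤ κ / (d + 1) * P i)
    (x : Fin (d + 1) → ℤ) (hx : ∀ i, 2 * |x i| ≤ P i) :
    ‖torusKernel f P x‖ ≤ A * (1 + 2 / (1 - Real.exp (-ρ))) ^ (d + 1) * Real.exp (-(κ / (d + 1) * supNorm x)) := by
  have hs : Summable (mFourierCoeff f) := summable_of_decay _ hκ hdec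
  rw [torusKernel_eq_periodise f hs hP x]
  have hx' : ∀ i, 2 * |(-x) i| ≤ (P i : ℤ) := fun i => by simpa using hx i
  have h := periodise_bound_supNorm_large (mFourierCoeff f) hκ hdec hρ hρP (-x) hx'
  rwa [supNorm_neg] at h

/-- **UNIFORM DECAY IN THE TORUS METRIC AT EVERY LATTICE POINT, large periods**: `‖ĉ(n)‖ ≤ A e^{−κ|n|_∞}`, `κ > 0`,
`P_i ≥ 1`, `ρ ≤ (κ/(d+1)) P_i` ⇒ `‖K_P(x)‖ ≤ A · (1 + 2/(1 − e^{−ρ}))^{d+1} · e^{−(κ/(d+1)) · torusSupNorm P x}`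
(periodicity + the centred statement at the centred representative). [folklore] -/
theorem torusKernel_decay_torusMetric_large (f : C(UnitAddTorus (Fin (d + 1)), ℂ)) {κ A : ℝ} (hκ : 0 < κ)
    (hdec : ∀ n, ‖mFourierCoeff f n‖ ≤ A * Real.exp (-(κ * supNorm n))) {P : Fin (d + 1) → ℕ}
    (hP : ∀ i, 1 ≤ P i) {ρ : ℝ} (hρ : 0 < ρ) (hρP : ∀ i, ρ ≤ κ / (d + 1) * P i) (x : Fin (d + 1) → ℤ) :
    ‖torusKernel f P x‖
      ≤ A * (1 + 2 / (1 - Real.exp (-ρ))) ^ (d + 1) * Real.exp (-(κ / (d + 1) * torusSupNorm P x)) := by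
  rw [← torusKernel_translate f hP x (centreVec P x), ← supNorm_translate_centreVec hP x]
  exact torusKernel_decay_large f hκ hdec hP hρ hρP _ (translate_centreVec_centred hP x)

/-- **THE TORUS KERNEL OF A STRIP-REGULAR MULTIPLIER, large periods**: `StripRegular G κ A`, `κ > 0`, `P_i ≥ 1`,
`ρ ≤ (κ/(d+1)) P_i` ⇒ `‖MultiPeriod.torusKernel (descendC G h _) P x‖ ≤ A · (1 + 2/(1 − e^{−ρ}))^{d+1} ·
e^{−(κ/(d+1)) · torusSupNorm P x}` for every `x ∈ ℤ^{d+1}` — to be compared with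
`B4TorusKernel.MultiPeriod.torusKernel_descend_decay_torusMetric` (constant `periodConst κ d ~ (2(d+1)/κ)^{d+1}` as
`κ → 0`). [cite: Balaban1984PropagatorsI, p. 36 l. 20–23 (location of the remark «relating G on the torus to G on the
whole lattice ηZ^d in the usual way»)] [folklore] -/
theorem torusKernel_descend_decay_torusMetric_large {G : (Fin (d + 1) → ℂ) → ℂ} {κ A : ℝ}
    (h : StripRegular G κ A) (hκ : 0 < κ) {P : Fin (d + 1) → ℕ} (hP : ∀ i, 1 ≤ P i)
    {ρ : ℝ} (hρ : 0 < ρ) (hρP : ∀ i, ρ ≤ κ / (d + 1) * P i) (x : Fin (d + 1) → ℤ) :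
    ‖torusKernel (descendC G h hκ.le) P x‖
      ≤ A * (1 + 2 / (1 - Real.exp (-ρ))) ^ (d + 1) * Real.exp (-(κ / (d + 1) * torusSupNorm P x)) :=
  torusKernel_decay_torusMetric_large _ hκ (norm_mFourierCoeff_descend_le h hκ.le) hP hρ hρP x

end Torus

/-! ## §4. Fine versus coarse torus distance: `n · dist(u, Mℤ) − |s| ≤ dist(nu + s, nMℤ)` -/

section Metric

/-- for `M, n ≥ 1` and all `u, s ∈ ℤ`: `n · circAbs M u − |s| ≤ circAbs (nM) (n u + s)` — a fine lattice point
`n u + s` at fine torus distance `D` from `nMℤ` has its coarse label `u` at coarse torus distance `≤ (D + |s|)/n` from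
`Mℤ`. [folklore] -/
theorem circAbs_fine_ge {M n : ℕ} (hM : 1 ≤ M) (hn : 1 ≤ n) (u s : ℤ) :
    (n : ℤ) * circAbs M u - |s| ≤ circAbs (n * M) (n * u + s) := by
  set k := centre (n * M) (n * u + s) with hk
  have hnM : 1 ≤ n * M := Nat.one_le_iff_ne_zero.mpr (Nat.mul_ne_zero (by omega) (by omega))
  have h1 : |n * u + s + ((n * M : ℕ) : ℤ) * k| = circAbs (n * M) (n * u + s) := abs_add_mul_centre hnM _
  have h2 : circAbs M (u + M * k) = circAbs M u := circAbs_add_mul M u k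
  have h3 : circAbs M (u + M * k) ≤ |u + M * k| := circAbs_le_abs hM _
  have h4 : |(n : ℤ) * (u + M * k)| = n * |u + M * k| := by rw [abs_mul, Nat.abs_cast]
  have h5 : |(n : ℤ) * (u + M * k)| ≤ |n * u + s + ((n * M : ℕ) : ℤ) * k| + |s| := by
    have e : (n : ℤ) * (u + M * k) = (n * u + s + ((n * M : ℕ) : ℤ) * k) - s := by push_cast; ring
    rw [e]
    exact abs_sub _ _
  rw [← h1]
  rw [h2] at h3
  have hn0 : (0 : ℤ) ≤ n := by positivity
  nlinarith [mul_le_mul_of_nonneg_left h3 hn0]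

/-- the vector form: for periods `M_i ≥ 1`, `n ≥ 1`, and offsets `|s_i| ≤ b`:
`n · |y|_{T_M,∞} − b ≤ |n y + s|_{T_{nM},∞}`. [folklore] -/
theorem torusSupNorm_fine_ge {M : Fin (d + 1) → ℕ} (hM : ∀ i, 1 ≤ M i) {n : ℕ} (hn : 1 ≤ n)
    (y s : Fin (d + 1) → ℤ) {b : ℤ} (hs : ∀ i, |s i| ≤ b) :
    (n : ℝ) * torusSupNorm M y - b
      ≤ torusSupNorm (fun i => n * M i) (fun i => (n : ℤ) * y i + s i) := by
  obtain ⟨i, _, hi⟩ := Finset.exists_mem_eq_sup' Finset.univ_nonempty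
    (fun i => ((circAbs (M i) (y i) : ℤ) : ℝ))
  have e : torusSupNorm M y = ((circAbs (M i) (y i) : ℤ) : ℝ) := hi
  rw [e]
  have h1 : ((n : ℤ) * circAbs (M i) (y i) - |s i| : ℤ) ≤ circAbs (n * M i) (n * y i + s i) :=
    circAbs_fine_ge (hM i) hn (y i) (s i)
  have h1' : (n : ℝ) * ((circAbs (M i) (y i) : ℤ) : ℝ) - ((|s i| : ℤ) : ℝ)
      ≤ ((circAbs (n * M i) (n * y i + s i) : ℤ) : ℝ) := by exact_mod_cast h1
  have h2 : ((circAbs (n * M i) (n * y i + s i) : ℤ) : ℝ)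
      ≤ torusSupNorm (fun i => n * M i) (fun i => (n : ℤ) * y i + s i) :=
    Finset.le_sup' (fun j => ((circAbs (n * M j) ((n : ℤ) * y j + s j) : ℤ) : ℝ)) (Finset.mem_univ i)
  have h3 : ((|s i| : ℤ) : ℝ) ≤ (b : ℝ) := by exact_mod_cast hs i
  linarith

end Metric

/-! ## §5. The `n`-UNIFORM free torus bound on the fine torus `T_η` (`P_i = n M_i`, `κ = r(d+1)/n`) -/

section Free

variable (n : ℕ) [NeZero n] (M : Fin (d + 1) → ℕ) [hM : ∀ μ, NeZero (M μ)]

/-- rate × period is bounded below uniformly in `n`: `r(d+1)/(d+1) ≤ ((r(d+1)/n)/(d+1)) · (n M_i)` (`M_i ≥ 1`). [folklore] -/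
theorem rho_le_rate_mul_fine (i : Fin (d + 1)) :
    rOf (d + 1) / (d + 1) ≤ (rOf (d + 1) / n) / (d + 1) * (fine n M i : ℕ) := by
  have hn : (0 : ℝ) < n := Nat.cast_pos.mpr (Nat.pos_of_ne_zero (NeZero.ne n))
  have hM1 : (1 : ℝ) ≤ M i := by exact_mod_cast one_le_M M i
  have hr : 0 ≤ rOf (d + 1) := (rOf_pos _).le
  have e : ((fine n M i : ℕ) : ℝ) = (n : ℝ) * (M i : ℝ) := by simp [fine]
  rw [e]
  have e2 : (rOf (d + 1) / n) / (d + 1) * ((n : ℝ) * (M i : ℝ)) = rOf (d + 1) / (d + 1) * M i := by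
    field_simp
  rw [e2]
  exact le_mul_of_one_le_right (div_nonneg hr (by positivity)) hM1

/-- `0 < r(d+1)/(d+1)`. [folklore] -/
theorem rho_pos (d : ℕ) : 0 < rOf (d + 1) / (d + 1) := div_pos (rOf_pos _) (by positivity)

/-- the `n`-uniform free torus constant is nonnegative. [folklore] -/
theorem freeConst_nonneg (d : ℕ) : 0 ≤ (1 + 2 / (1 - Real.exp (-(rOf (d + 1) / (d + 1))))) ^ (d + 1) := by
  have h : Real.exp (-(rOf (d + 1) / (d + 1))) < 1 := Real.exp_lt_one_iff.mpr (by linarith [rho_pos d])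
  exact pow_nonneg (add_nonneg zero_le_one (div_nonneg zero_le_two (by linarith))) _

/-- **THE `n`-UNIFORM EXPONENTIAL DECAY OF THE FINE-TORUS KERNEL OF THE FREE PART** (closes `B5G183FreeDecay`
HONEST SCOPE (v)): for every `n ≥ 1`, `N`, every coarse torus `M` (`M_i ≥ 1`) and every `m ∈ ℤ^{d+1}`,
`‖MultiPeriod.torusKernel (descendC (freeMult n N)) (fine n M) m‖ ≤
MF(N) · (1 + 2/(1 − e^{−r(d+1)/(d+1)}))^{d+1} · e^{−((r(d+1)/n)/(d+1)) · |m|_{T_η,∞}}` — rate `r(d+1)/(d+1)` per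
COARSE unit (`|ηm| = |m|/n`) and a constant depending on `d, N` ONLY (compare
`B5G183FreeDecay.torusKernel_freeMult_decay`: constant `periodConst (r(d+1)/n) d ~ (2n(d+1)/r(d+1))^{d+1}`).
[cite: Balaban1984PropagatorsI, p. 36 l. 20–23 (location of the remark)] [folklore] -/
theorem torusKernel_freeMult_decay_uniform (N : ℕ) (m : Fin (d + 1) → ℤ) :
    ‖torusKernel (descendC (fun q : Fin (d + 1) → ℂ => freeMult n N q)
        (stripRegular_freeMult n (rOf_div_pos n d).le (rOf_div_admissible n d) N)
        (rOf_div_pos n d).le) (fine n M) m‖ ≤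
      MF N * (1 + 2 / (1 - Real.exp (-(rOf (d + 1) / (d + 1))))) ^ (d + 1) *
        Real.exp (-((rOf (d + 1) / n) / (d + 1) * torusSupNorm (fine n M) m)) :=
  torusKernel_descend_decay_torusMetric_large _ (rOf_div_pos n d) (one_le_M (fine n M)) (rho_pos d)
    (rho_le_rate_mul_fine n M) m

end Free

/-! ## §6. Block points: the free part and the whole kernel of `G = Δ_1⁻¹` in the COARSE torus distance, `n`-uniformly -/

section Block

variable (n : ℕ) [NeZero n] (hn : 1 ≤ n) (M : Fin (d + 1) → ℕ) [hM : ∀ μ, NeZero (M μ)]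

omit [NeZero n] in
/-- offsets inside a block differ by at most `n − 1`. [folklore] -/
theorem abs_offset_sub_le (a b : Fin n) : |(((a : ℕ) : ℤ)) - ((b : ℕ) : ℤ)| ≤ (n : ℤ) - 1 := by
  have ha := a.isLt
  have hb := b.isLt
  rw [abs_sub_le_iff]
  constructor <;> omega

omit [NeZero n] in
include hn in
/-- the fine torus distance of two block points controls the coarse torus distance of their blocks:
`n · |x − x′|_{T₁,∞} − (n − 1) ≤ |(n x + r) − (n x′ + r′)|_{T_η,∞}`. [folklore] -/
theorem torusSupNorm_bpt_ge (x x' : Fin (d + 1) → ℤ) (r r' : Fin (d + 1) → Fin n) :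
    (n : ℝ) * torusSupNorm M (x - x') - ((n : ℝ) - 1)
      ≤ torusSupNorm (fine n M)
          ((fun i => (n : ℤ) * x i + ((r i : ℕ) : ℤ)) - (fun i => (n : ℤ) * x' i + ((r' i : ℕ) : ℤ))) := by
  have e : ((fun i => (n : ℤ) * x i + ((r i : ℕ) : ℤ)) - (fun i => (n : ℤ) * x' i + ((r' i : ℕ) : ℤ)))
      = fun i => (n : ℤ) * (x - x') i + ((((r i : ℕ) : ℤ)) - ((r' i : ℕ) : ℤ)) := by
    funext i
    simp only [Pi.sub_apply]
    ring
  rw [e]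
  have h := torusSupNorm_fine_ge (one_le_M M) hn (x - x')
    (fun i => (((r i : ℕ) : ℤ)) - ((r' i : ℕ) : ℤ)) (fun i => abs_offset_sub_le n (r i) (r' i))
  have e2 : (((n : ℤ) - 1 : ℤ) : ℝ) = (n : ℝ) - 1 := by push_cast; ring
  rw [e2] at h
  exact h

omit [NeZero n] in
include hn in
/-- the exponential weights compared: `e^{−((ρ n⁻¹)·|(n x + r) − (n x′ + r′)|_{T_η,∞})} ≤ e^{ρ} · e^{−ρ|x − x′|_{T₁,∞}}`
for every `ρ ≥ 0`. [folklore] -/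
theorem exp_fine_le_exp_coarse {ρ : ℝ} (hρ : 0 ≤ ρ) (x x' : Fin (d + 1) → ℤ) (r r' : Fin (d + 1) → Fin n) :
    Real.exp (-((ρ / n) * torusSupNorm (fine n M)
        ((fun i => (n : ℤ) * x i + ((r i : ℕ) : ℤ)) - (fun i => (n : ℤ) * x' i + ((r' i : ℕ) : ℤ)))))
      ≤ Real.exp ρ * Real.exp (-(ρ * torusSupNorm M (x - x'))) := by
  rw [← Real.exp_add]
  apply Real.exp_le_exp.mpr
  have h := torusSupNorm_bpt_ge n hn M x x' r r'
  have hnpos : (0 : ℝ) < n := by exact_mod_cast hn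
  have hT : 0 ≤ torusSupNorm M (x - x') := torusSupNorm_nonneg (one_le_M M) _
  set T := torusSupNorm (fine n M)
    ((fun i => (n : ℤ) * x i + ((r i : ℕ) : ℤ)) - (fun i => (n : ℤ) * x' i + ((r' i : ℕ) : ℤ))) with hTdef
  -- ρ/n · T ≥ ρ/n · (n T_c − (n − 1)) = ρ T_c − ρ (n−1)/n ≥ ρ T_c − ρ
  have h1 : ρ / n * ((n : ℝ) * torusSupNorm M (x - x') - ((n : ℝ) - 1)) ≤ ρ / n * T :=
    mul_le_mul_of_nonneg_left h (div_nonneg hρ hnpos.le)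
  have h2 : ρ / n * ((n : ℝ) * torusSupNorm M (x - x') - ((n : ℝ) - 1))
      = ρ * torusSupNorm M (x - x') - ρ * (((n : ℝ) - 1) / n) := by
    field_simp
  have h3 : ρ * (((n : ℝ) - 1) / n) ≤ ρ := by
    have : ((n : ℝ) - 1) / n ≤ 1 := by
      rw [div_le_one hnpos]
      linarith
    nlinarith
  linarith

include hn in
/-- **THE FREE PART BETWEEN BLOCK POINTS, `n`-UNIFORMLY, IN THE COARSE TORUS DISTANCE**:
`‖[Σ_{j<N}((Lap+1)⁻¹)^{j+1}]_{(n x̄+r,μ),(n x̄′+r′,ν)}‖ ≤ MF(N)·(1 + 2/(1 − e^{−ρ_F}))^{d+1}·e^{ρ_F}·e^{−ρ_F|x − x′|_{T₁,∞}}`,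
`ρ_F = r(d+1)/(d+1)` — every constant a function of `d, N` only. [cite: Balaban1984PropagatorsI, Prop. 1.2 (1.110)
p.35 (location; kernel-level `a = 1` companion of the free part, constants ours)] [folklore] -/
theorem norm_freePart_bpt_le_uniform (N : ℕ) (x x' : Fin (d + 1) → ℤ) (r r' : Fin (d + 1) → Fin n)
    (μ ν : Fin (d + 1)) :
    ‖(∑ j ∈ Finset.range N, ((Lap n M + 1)⁻¹) ^ (j + 1)) (bpt n M (toT M x) r, μ) (bpt n M (toT M x') r', ν)‖
      ≤ MF N * (1 + 2 / (1 - Real.exp (-(rOf (d + 1) / (d + 1))))) ^ (d + 1) *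
          Real.exp (rOf (d + 1) / (d + 1)) *
          Real.exp (-(rOf (d + 1) / (d + 1) * torusSupNorm M (x - x'))) := by
  rw [bpt_toT, bpt_toT, freePart_toT_eq_torusKernel]
  have hC := freeConst_nonneg d
  have hF := MF_nonneg N
  by_cases h : μ = ν
  · rw [if_pos h]
    refine (torusKernel_freeMult_decay_uniform n M N _).trans ?_
    have hrate : (rOf (d + 1) / n) / (d + 1) = (rOf (d + 1) / (d + 1)) / n := by
      rw [div_div, div_div, mul_comm]
    rw [hrate, mul_assoc (MF N * _ ) (Real.exp _)]
    exact mul_le_mul_of_nonneg_left (exp_fine_le_exp_coarse n hn M (rho_pos d).le x x' r r')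
      (mul_nonneg hF hC)
  · rw [if_neg h, norm_zero]
    positivity

include hn in
/-- **THE `n`-UNIFORM ENTRYWISE EXPONENTIAL DECAY OF THE KERNEL OF `G = Δ_1⁻¹` BETWEEN BLOCK POINTS IN THE COARSE
TORUS DISTANCE OF THEIR BLOCKS** (free part: this leaf; covariant part:
`B5G183KernelDecay.norm_DeltaA_one_inv_bpt_sub_free_le` BY NAME): for `a = 1`, `U = 1`, every `n ≥ 1`, `N + 1 ≥ d + 1`,
every coarse torus `M` and all block points `n·x̄ + r`, `n·x̄′ + r′`,
`‖(Δ_1⁻¹)_{(n x̄+r,μ),(n x̄′+r′,ν)}‖ ≤ MF(N)·(1 + 2/(1 − e^{−ρ_F}))^{d+1}·e^{ρ_F}·e^{−ρ_F|x − x′|_{T₁,∞}}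
 + n^{−(d+1)}·MD183(d+1,N)·periodConst(κ₁₈₃(d+1),d)·e^{−(κ₁₈₃(d+1)/(d+1))|x − x′|_{T₁,∞}}`, `ρ_F = r(d+1)/(d+1)` —
EVERY constant and rate a function of `d, N` only.  HONEST SCOPE: entries, not the operator form of (1.110); `a = 1`,
`U = 1`; finite torus; constants ours. [cite: Balaban1984PropagatorsI, Prop. 1.2 (1.110) p.35 (location; kernel-level
`a = 1` companion, constants ours)] [folklore] -/
theorem norm_DeltaA_one_inv_bpt_le_uniform {N : ℕ} (hN : d + 1 ≤ N + 1) (x x' : Fin (d + 1) → ℤ)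
    (r r' : Fin (d + 1) → Fin n) (μ ν : Fin (d + 1)) :
    ‖(DeltaA n M 1)⁻¹ (bpt n M (toT M x) r, μ) (bpt n M (toT M x') r', ν)‖
      ≤ MF N * (1 + 2 / (1 - Real.exp (-(rOf (d + 1) / (d + 1))))) ^ (d + 1) *
          Real.exp (rOf (d + 1) / (d + 1)) *
          Real.exp (-(rOf (d + 1) / (d + 1) * torusSupNorm M (x - x')))
        + ((n : ℝ) ^ (d + 1))⁻¹ * (MD183 (d + 1) N * periodConst (kappa183 (d + 1)) d *
          Real.exp (-(kappa183 (d + 1) / (d + 1) * torusSupNorm M (x - x')))) := by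
  have hcov := norm_DeltaA_one_inv_bpt_sub_free_le n hn M hN x x' r r' μ ν
  have hfree := norm_freePart_bpt_le_uniform n hn M N x x' r r' μ ν
  have key : ∀ (G F : ℂ), ‖G‖ ≤ ‖F‖ + ‖G - F‖ := fun G F => by
    calc ‖G‖ = ‖F + (G - F)‖ := by rw [add_sub_cancel]
      _ ≤ ‖F‖ + ‖G - F‖ := norm_add_le _ _
  exact (key _ _).trans (add_le_add hfree hcov)

include hn in
/-- **SINGLE-RATE FORM** (the shape `O(1)·e^{−δ₀|y − y′|}` of (1.110), kernel level, constants ours): with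
`δ(d) = min(r(d+1)/(d+1), κ₁₈₃(d+1)/(d+1))` and `n^{−(d+1)} ≤ 1`,
`‖(Δ_1⁻¹)_{(n x̄+r,μ),(n x̄′+r′,ν)}‖ ≤ (MF(N)·(1 + 2/(1 − e^{−ρ_F}))^{d+1}·e^{ρ_F} + MD183(d+1,N)·periodConst(κ₁₈₃(d+1),d))
· e^{−δ(d)·|x − x′|_{T₁,∞}}` — uniformly in `n = L^k` and in the torus. [cite: Balaban1984PropagatorsI, Prop. 1.2 (1.110)
p.35 (location; kernel-level `a = 1` companion, constants ours)] [folklore] -/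
theorem norm_DeltaA_one_inv_bpt_le_uniform' {N : ℕ} (hN : d + 1 ≤ N + 1) (x x' : Fin (d + 1) → ℤ)
    (r r' : Fin (d + 1) → Fin n) (μ ν : Fin (d + 1)) :
    ‖(DeltaA n M 1)⁻¹ (bpt n M (toT M x) r, μ) (bpt n M (toT M x') r', ν)‖
      ≤ (MF N * (1 + 2 / (1 - Real.exp (-(rOf (d + 1) / (d + 1))))) ^ (d + 1) *
            Real.exp (rOf (d + 1) / (d + 1))
          + MD183 (d + 1) N * periodConst (kappa183 (d + 1)) d) *
        Real.exp (-(min (rOf (d + 1) / (d + 1)) (kappa183 (d + 1) / (d + 1)) * torusSupNorm M (x - x'))) := by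
  refine (norm_DeltaA_one_inv_bpt_le_uniform n hn M hN x x' r r' μ ν).trans ?_
  set T := torusSupNorm M (x - x') with hT
  set δ := min (rOf (d + 1) / (d + 1)) (kappa183 (d + 1) / (d + 1)) with hδ
  have hT0 : 0 ≤ T := torusSupNorm_nonneg (one_le_M M) _
  have hA : 0 ≤ MF N * (1 + 2 / (1 - Real.exp (-(rOf (d + 1) / (d + 1))))) ^ (d + 1) *
      Real.exp (rOf (d + 1) / (d + 1)) := mul_nonneg (mul_nonneg (MF_nonneg N) (freeConst_nonneg d)) (Real.exp_pos _).le
  have hB : 0 ≤ MD183 (d + 1) N * periodConst (kappa183 (d + 1)) d :=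
    mul_nonneg (MD183_nonneg _ _) (periodConst_pos (kappa183_pos _) d).le
  have h1 : Real.exp (-(rOf (d + 1) / (d + 1) * T)) ≤ Real.exp (-(δ * T)) :=
    Real.exp_le_exp.mpr (by nlinarith [min_le_left (rOf (d + 1) / (d + 1)) (kappa183 (d + 1) / (d + 1))])
  have h2 : Real.exp (-(kappa183 (d + 1) / (d + 1) * T)) ≤ Real.exp (-(δ * T)) :=
    Real.exp_le_exp.mpr (by nlinarith [min_le_right (rOf (d + 1) / (d + 1)) (kappa183 (d + 1) / (d + 1))])
  have hn1 : ((n : ℝ) ^ (d + 1))⁻¹ ≤ 1 := by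
    apply inv_le_one_of_one_le₀
    exact one_le_pow₀ (by exact_mod_cast hn)
  have h3 : ((n : ℝ) ^ (d + 1))⁻¹ * (MD183 (d + 1) N * periodConst (kappa183 (d + 1)) d *
      Real.exp (-(kappa183 (d + 1) / (d + 1) * T)))
      ≤ MD183 (d + 1) N * periodConst (kappa183 (d + 1)) d * Real.exp (-(δ * T)) := by
    calc ((n : ℝ) ^ (d + 1))⁻¹ * (MD183 (d + 1) N * periodConst (kappa183 (d + 1)) d *
          Real.exp (-(kappa183 (d + 1) / (d + 1) * T)))
        ≤ 1 * (MD183 (d + 1) N * periodConst (kappa183 (d + 1)) d *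
          Real.exp (-(kappa183 (d + 1) / (d + 1) * T))) :=
          mul_le_mul_of_nonneg_right hn1 (mul_nonneg hB (Real.exp_pos _).le)
      _ ≤ MD183 (d + 1) N * periodConst (kappa183 (d + 1)) d * Real.exp (-(δ * T)) := by
          rw [one_mul]
          exact mul_le_mul_of_nonneg_left h2 hB
  have h4 : MF N * (1 + 2 / (1 - Real.exp (-(rOf (d + 1) / (d + 1))))) ^ (d + 1) *
        Real.exp (rOf (d + 1) / (d + 1)) * Real.exp (-(rOf (d + 1) / (d + 1) * T))
      ≤ MF N * (1 + 2 / (1 - Real.exp (-(rOf (d + 1) / (d + 1))))) ^ (d + 1) *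
        Real.exp (rOf (d + 1) / (d + 1)) * Real.exp (-(δ * T)) := mul_le_mul_of_nonneg_left h1 hA
  calc _ ≤ MF N * (1 + 2 / (1 - Real.exp (-(rOf (d + 1) / (d + 1))))) ^ (d + 1) *
        Real.exp (rOf (d + 1) / (d + 1)) * Real.exp (-(δ * T))
        + MD183 (d + 1) N * periodConst (kappa183 (d + 1)) d * Real.exp (-(δ * T)) := add_le_add h4 h3
    _ = _ := by ring

end Block

end

end Literature.MathematicalPhysics.QuantumFieldTheory.Balaban1983to89.B5G183FreeUniform
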